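import Mathlib.GroupTheory.Commensurable
import Mathlib.Algebra.Group.Subgroup.Pointwise
import Mathlib.Topology.Algebra.ContinuousMonoidHom
import Literature.AnabelianGeometry.SemiGraphs.TemperedAnabelian

/-!
# [AbsTopI] Prop 4.10 (Basic properties of tempered fundamental groups) — items (iv), (vi)

S. Mochizuki, *Topics in Absolute Anabelian Geometry I* (2012) [AbsTopI] §4, Prop 4.10 pp. 60–61
(manuscript pagination, lit key paper:url-11ac98ba15fc): the tempered fundamental group
`Π^{tp}_X` of a hyperbolic orbicurve over an MLF versus its profinite completion `π₁(X)`; cited by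
[IUTchI] p. 107 ((i)) and [IUTchII] p. 68 ((vi)).

Library fit.  The tempered curve interface is abc-iut-L3's
`Literature.AnabelianGeometry.SemiGraphs.TemperedCurve p` (TemperedAnabelian.lean), whose FIELD
`toHat_injective` ("natural injection `Π^{temp} ↪ Π̂`", [SemiAnbd] §6 p. 69) IS Prop 4.10 (i)
"the natural homomorphism `Π^{tp}_X → Π̂^{tp}_X ≅ π₁(X)` is injective", and whose predicate
`TemperedCurve.PiTempNormallyTerminal` ([SemiAnbd] Lemma 6.1 (iii) — the result Prop 4.10 (ii)'s
proof cites) IS Prop 4.10 (ii) "`Π^{tp}_X` is normally terminal in `Π̂^{tp}_X`"; they are not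
re-declared here (pointer decl `prop410_i_ii_pointer` below).  This file adds, as PREDICATES on
abstract data `H[l]` ("the co-free completion of `H` with respect to the maximal pro-`l` quotient of
its profinite completion", `l ≠ p`, with its verticial / edge-like subgroups, [Mzk10] Thm 3.7):
(iv) `VerticialEdgeLikeCharacterized` and (vi) `CuspsViaEdgeLike` (as printed: commensurators of
images of edge-like subgroups of `J[l]` not contained in edge-like subgroups of `H[l]`).  Items
(iii) (reconstruction of `Π^{tp}_X → Π^{tp}_Y` via co-free completions) and (v) (the
characterisation of `p`) are NOT typed (they need the co-free completion as a construction,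
[AbsTopI] §0 p. 8).
-/

noncomputable section

open scoped Pointwise

universe u

namespace Literature.AnabelianGeometry.AbsoluteAnabelian

open Literature.AnabelianGeometry.SemiGraphs

/-- [AbsTopI] Prop 4.10 (i) and (ii), POINTER (no new content): for a tempered curve `X` in the
sense of abc-iut-L3's interface, (i) "`Π^{tp}_X → Π̂^{tp}_X` is injective" is the field
`X.toHat_injective`, and (ii) "`Π^{tp}_X` is normally terminal in `Π̂^{tp}_X`" is
`X.PiTempNormallyTerminal`; the conjunction is recorded under the [AbsTopI] locator for the
citation census. [cite: MochizukiAbsTopI2012, Prop 4.10 (i) p.60] -/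
def prop410_i_ii_pointer {p : ℕ} [Fact p.Prime] (X : TemperedCurve p) : Prop :=
  Function.Injective X.toHat ∧ X.PiTempNormallyTerminal

/-- [AbsTopI] Prop 4.10 (iv) as a predicate on abstract data `(H[l], verticial, edge-like
subgroups)`: "The verticial (respectively, edge-like) subgroups of `H[l]` may be characterized
["group-theoretically"] as the maximal compact subgroups (respectively, nontrivial intersections of
two distinct maximal compact subgroups) of `H[l]`." [cite: MochizukiAbsTopI2012, Prop 4.10 (iv) p.60] -/
def VerticialEdgeLikeCharacterized {Hl : Type u} [Group Hl] [TopologicalSpace Hl]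
    (verticial edgeLike : Set (Subgroup Hl)) : Prop :=
  (verticial = {V : Subgroup Hl | IsCompact (V : Set Hl) ∧
      ∀ W : Subgroup Hl, IsCompact (W : Set Hl) → V ≤ W → V = W}) ∧
    edgeLike = {A : Subgroup Hl | A ≠ ⊥ ∧ ∃ V ∈ verticial, ∃ W ∈ verticial, V ≠ W ∧ A = V ⊓ W}

/-- The candidate cuspidal subgroups of `H[l]` of [AbsTopI] Prop 4.10 (vi): "the commensurators
in `H[l]` of the images in `H[l]` of edge-like subgroups of `J[l]` [cf. (iv)], where `J ⊆ H` is an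
open subgroup of finite index, which are not contained in edge-like subgroups of `H[l]`" — for
the declared datum `ι : J[l] → H[l]` (induced by `J ⊆ H`) and the edge-like families.
[cite: MochizukiAbsTopI2012, Prop 4.10 (vi) p.61] -/
def cuspidalCandidates {Hl Jl : Type u} [Group Hl] [Group Jl] (ι : Jl →* Hl)
    (edgeJ : Set (Subgroup Jl)) (edgeH : Set (Subgroup Hl)) : Set (Subgroup Hl) :=
  {D | ∃ e ∈ edgeJ, (¬ ∃ e' ∈ edgeH, e.map ι ≤ e') ∧
    D = Subgroup.Commensurable.commensurator (e.map ι)}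

/-- [AbsTopI] Prop 4.10 (vi) as a predicate: "the set of cusps of the covering of `X_k̄`
corresponding to `H` may be characterized ["group-theoretically"] as the set of conjugacy classes in
`H[l]` of" the candidate cuspidal subgroups (`cuspidalCandidates`, over SOME open finite-index
`J ⊆ H` from a declared family of data `ι_J : J[l] → H[l]` with their edge-like subgroups) — typed
for the declared set `cuspsHl` of decomposition groups of cusps in `H[l]` (a union of `H[l]`-conjugacy
classes): it is the conjugacy-closure of the candidates.  ("In particular, by allowing `H` to vary,
this yields a ["group-theoretic"] characterization of the decomposition groups of cusps in
`Δ^{tp}_X`, `Π^{tp}_X`", the tempered version of Lemma 4.5 (v), is not typed separately.)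
[cite: MochizukiAbsTopI2012, Prop 4.10 (vi) p.61] -/
def CuspsViaEdgeLike {Hl : Type u} [Group Hl] (edgeH : Set (Subgroup Hl))
    {ι_idx : Type u} (Jl : ι_idx → Type u) [∀ i, Group (Jl i)] (ι : ∀ i, Jl i →* Hl)
    (edgeJ : ∀ i, Set (Subgroup (Jl i))) (cuspsHl : Set (Subgroup Hl)) : Prop :=
  cuspsHl = {D | ∃ (i : ι_idx) (g : Hl), ∃ D₀ ∈ cuspidalCandidates (ι i) (edgeJ i) edgeH,
    D = MulAut.conj g • D₀}

end Literature.AnabelianGeometry.AbsoluteAnabelian
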